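import Summits.ValiantsHypothesis.ValiantsHypothesis.Theorems.LacunarySymmetroidMatrixDescartesCensusDoorA34NullNullConsistency

/-!
# `MatrixDescartes` census — DOOR A at `(3,4)`: the null-null sign tests read from a NEGATIVE semidefinite end (`S ↦ −S` transports of the end-edge and
# type-DI tests) and the NAPPE TEST read from the bottom end — the six test shapes the ORIENTED chamber closures of the null-null atlas still needed

HONEST FRAMING.  Object-search cell `pub-symmetroid`, engine seat `val-sym-eng-2` (g8); helper rows beside the registered strata line
`Cruxes/DoorA34/Lines/strata.lean` on stmt-ValiantsHypothesis-19980 (`DoorA34 = PosRootLawAt 3 4 18`: OPEN, typed, never asserted here); third stub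
`stub_nullNullCeiling` (`det S₀ = det S₃ = 0 ⇒ ≤ 16`).  The located sign atlas of the null-null sheet (HOME/DOOR-A34-ENG2G5-REPORT.md §4: `80` exponent chambers ×
`9` cells, orientation `c_{001} > 0`; `528` classes killed, `192` realised) is being re-issued as theorems for EVERY support of each chamber: g6 did the `160`
orientation-free end-cell classes (…NullNullChamberEndsA–E); the remaining `368` ORIENTED kills run g5's decidable tests (…NullNullEndTests / …PairTests /
…HiddenTypes / …EndEdge / …Consistency).  Those tests are stated for a POSITIVE semidefinite reading end; the negative readings follow by `S ↦ −S`
(`posRoots_pencil_neg_three`; pattern of `card_posRoots_le_16_of_nullNull_topEndTest_neg`).  This file supplies the transports the chamber closures use and the one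
missing test shape:
* `card_posRoots_le_16_of_nullNull_topEndEdgeTest_neg` / `…bottomEndEdgeTest_neg` (pinning end `S₃ ⪯ 0` / `S₀ ⪯ 0`);
* `card_posRoots_le_16_of_nullNull_topTypeTestDI_neg` / `…bottomTypeTestDI_neg`;
* **`card_posRoots_le_16_of_nullNull_bottomNappeTest`** (nappe law of a middle letter hidden-definite from the bottom end `S₀ ⪰ 0`; mirror of
  `…topNappeTest`) and `…bottomNappeTest_neg`.
Nothing here bounds anything else; `DoorA34` and the three stubs stay OPEN; registers unchanged; nothing on `MatrixDescartes` (stmt-ValiantsHypothesis-18050) or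
`VP ≠ VNP` — VP≠VNP not moved.  [folklore] Descartes bookkeeping; elementary.
-/

-- `Summit.ValiantsHypothesis.ValiantsHypothesis.…` repeats a component by the D-0017 layout
-- (single-conjunct summit), which the `dupNamespace` linter flags; the name is mandated.
set_option linter.dupNamespace false

namespace Summit.ValiantsHypothesis.ValiantsHypothesis.Theorems.LacunarySymmetroidMatrixDescartes.Census

open Polynomial Finset Matrix
open scoped BigOperators Polynomial Matrix

/-! ## 1. End-edge tests read from a negative semidefinite end -/

/-- **TOP END-EDGE TEST with pinning end `S₃ ⪯ 0`** (transport of `card_posRoots_le_16_of_nullNull_topEndEdgeTest` along `S ↦ −S`: all slot signs and both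
end cells flip, parities stay). [folklore] -/
theorem card_posRoots_le_16_of_nullNull_topEndEdgeTest_neg (d : Fin 4 → ℕ) (hd : StrictMono d) (S : Fin 4 → Matrix (Fin 3) (Fin 3) ℝ)
    (hS : ∀ l, (S l).IsSymm) (h0 : (S 0).det = 0) (h3 : (S 3).det = 0) (hnsd : (-(S 3)).PosSemidef)
    (ρ : ℕ → ℕ) (hρ : ∀ n, ρ n = ((((((Finset.univ : Finset (Sym (Fin 4) 3)).erase (Sym.replicate 3 3)).erase (Sym.replicate 3 0)).image
          (fun s : Sym (Fin 4) 3 => ((s : Multiset (Fin 4)).map d).sum)).filter (· < n)).card))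
    {x : Fin 4} (hx0 : x ≠ 0) (hx3 : x ≠ 3)
    (hor : (-1 : ℝ) ^ ρ (2 * d x + d 3) * ((S 0).adjugate * S 1).trace < 0)
    (hxdef : (ρ (3 * d x) + ρ (2 * d 3 + d x)) % 2 = 0)
    (hkill : ((-(S 0)).PosSemidef ∧ (0 < (-1 : ℝ) ^ ρ (2 * d x + d 0) * ((S 0).adjugate * S 1).trace ∨ ρ (2 * d 0 + d x) % 2 ≠ ρ (2 * d 3 + d x) % 2))
      ∨ ((S 0).PosSemidef ∧ ((-1 : ℝ) ^ ρ (2 * d x + d 0) * ((S 0).adjugate * S 1).trace < 0 ∨ ρ (2 * d 0 + d x) % 2 ≠ ρ (2 * d 3 + d x) % 2))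
      ∨ ((¬ (S 0).PosSemidef ∧ ¬ (-S 0).PosSemidef) ∧ ρ (2 * d 0 + d x) % 2 = ρ (2 * d 3 + d x) % 2)) :
    ((Matrix.det (∑ l, ((X : ℝ[X]) ^ d l) • (S l).map C)).roots.toFinset.filter (fun t => 0 < t)).card ≤ 16 := by
  have hc : ∀ X : Matrix (Fin 3) (Fin 3) ℝ, ((-S 0).adjugate * (-X)).trace = -(((S 0).adjugate * X).trace) := fun X => by
    rw [show (-S 0).adjugate = (S 0).adjugate from by rw [← neg_one_smul ℝ (S 0), Matrix.adjugate_smul]; simp, Matrix.mul_neg, Matrix.trace_neg]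
  have hdet : ∀ l, ((fun l => -S l) l).det = -(S l).det := fun l => by simp only [Matrix.det_neg, Fintype.card_fin]; norm_num
  have h := card_posRoots_le_16_of_nullNull_topEndEdgeTest d hd (fun l => -S l) (fun l => (hS l).neg) (by rw [hdet, h0, neg_zero])
    (by rw [hdet, h3, neg_zero]) hnsd ρ hρ (x := x) hx0 hx3 (by rw [hc, mul_neg]; linarith) hxdef ?_
  · rwa [posRoots_pencil_neg_three] at h
  · rw [hc]
    rcases hkill with ⟨hn0, hu | hv⟩ | ⟨hp0, hu | hv⟩ | ⟨⟨hnp, hnn⟩, hu⟩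
    · exact Or.inl ⟨hn0, Or.inl (by rw [mul_neg]; linarith)⟩
    · exact Or.inl ⟨hn0, Or.inr hv⟩
    · exact Or.inr (Or.inl ⟨by simpa using hp0, Or.inl (by rw [mul_neg]; linarith)⟩)
    · exact Or.inr (Or.inl ⟨by simpa using hp0, Or.inr hv⟩)
    · exact Or.inr (Or.inr ⟨⟨hnn, by simpa using hnp⟩, hu⟩)

/-- **BOTTOM END-EDGE TEST with pinning end `S₀ ⪯ 0`** (transport of `card_posRoots_le_16_of_nullNull_bottomEndEdgeTest` along `S ↦ −S`). [folklore] -/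
theorem card_posRoots_le_16_of_nullNull_bottomEndEdgeTest_neg (d : Fin 4 → ℕ) (hd : StrictMono d) (S : Fin 4 → Matrix (Fin 3) (Fin 3) ℝ)
    (hS : ∀ l, (S l).IsSymm) (h0 : (S 0).det = 0) (h3 : (S 3).det = 0) (hnsd : (-(S 0)).PosSemidef)
    (ρ : ℕ → ℕ) (hρ : ∀ n, ρ n = ((((((Finset.univ : Finset (Sym (Fin 4) 3)).erase (Sym.replicate 3 3)).erase (Sym.replicate 3 0)).image
          (fun s : Sym (Fin 4) 3 => ((s : Multiset (Fin 4)).map d).sum)).filter (· < n)).card))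
    {x : Fin 4} (hx0 : x ≠ 0) (hx3 : x ≠ 3)
    (hor : (-1 : ℝ) ^ ρ (2 * d x + d 0) * ((S 0).adjugate * S 1).trace < 0)
    (hxdef : (ρ (3 * d x) + ρ (2 * d 0 + d x)) % 2 = 0)
    (hkill : ((-(S 3)).PosSemidef ∧ (0 < (-1 : ℝ) ^ ρ (2 * d x + d 3) * ((S 0).adjugate * S 1).trace ∨ ρ (2 * d 3 + d x) % 2 ≠ ρ (2 * d 0 + d x) % 2))
      ∨ ((S 3).PosSemidef ∧ ((-1 : ℝ) ^ ρ (2 * d x + d 3) * ((S 0).adjugate * S 1).trace < 0 ∨ ρ (2 * d 3 + d x) % 2 ≠ ρ (2 * d 0 + d x) % 2))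
      ∨ ((¬ (S 3).PosSemidef ∧ ¬ (-S 3).PosSemidef) ∧ ρ (2 * d 3 + d x) % 2 = ρ (2 * d 0 + d x) % 2)) :
    ((Matrix.det (∑ l, ((X : ℝ[X]) ^ d l) • (S l).map C)).roots.toFinset.filter (fun t => 0 < t)).card ≤ 16 := by
  have hc : ∀ X : Matrix (Fin 3) (Fin 3) ℝ, ((-S 0).adjugate * (-X)).trace = -(((S 0).adjugate * X).trace) := fun X => by
    rw [show (-S 0).adjugate = (S 0).adjugate from by rw [← neg_one_smul ℝ (S 0), Matrix.adjugate_smul]; simp, Matrix.mul_neg, Matrix.trace_neg]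
  have hdet : ∀ l, ((fun l => -S l) l).det = -(S l).det := fun l => by simp only [Matrix.det_neg, Fintype.card_fin]; norm_num
  have h := card_posRoots_le_16_of_nullNull_bottomEndEdgeTest d hd (fun l => -S l) (fun l => (hS l).neg) (by rw [hdet, h0, neg_zero])
    (by rw [hdet, h3, neg_zero]) hnsd ρ hρ (x := x) hx0 hx3 (by rw [hc, mul_neg]; linarith) hxdef ?_
  · rwa [posRoots_pencil_neg_three] at h
  · rw [hc]
    rcases hkill with ⟨hn3, hu | hv⟩ | ⟨hp3, hu | hv⟩ | ⟨⟨hnp, hnn⟩, hu⟩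
    · exact Or.inl ⟨hn3, Or.inl (by rw [mul_neg]; linarith)⟩
    · exact Or.inl ⟨hn3, Or.inr hv⟩
    · exact Or.inr (Or.inl ⟨by simpa using hp3, Or.inl (by rw [mul_neg]; linarith)⟩)
    · exact Or.inr (Or.inl ⟨by simpa using hp3, Or.inr hv⟩)
    · exact Or.inr (Or.inr ⟨⟨hnn, by simpa using hnp⟩, hu⟩)

/-! ## 2. Type tests DI read from a negative semidefinite end -/

/-- **TYPE TEST DI from the top end `S₃ ⪯ 0`** (transport of `card_posRoots_le_16_of_nullNull_topTypeTestDI`; only the orientation flips). [folklore] -/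
theorem card_posRoots_le_16_of_nullNull_topTypeTestDI_neg (d : Fin 4 → ℕ) (hd : StrictMono d) (S : Fin 4 → Matrix (Fin 3) (Fin 3) ℝ)
    (hS : ∀ l, (S l).IsSymm) (h0 : (S 0).det = 0) (h3 : (S 3).det = 0) (hnsd : (-(S 3)).PosSemidef)
    (ρ : ℕ → ℕ) (hρ : ∀ n, ρ n = ((((((Finset.univ : Finset (Sym (Fin 4) 3)).erase (Sym.replicate 3 3)).erase (Sym.replicate 3 0)).image
          (fun s : Sym (Fin 4) 3 => ((s : Multiset (Fin 4)).map d).sum)).filter (· < n)).card))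
    {x y : Fin 4} (hxy : x ≠ y) (hx0 : x ≠ 0) (hx3 : x ≠ 3) (hy0 : y ≠ 0) (hy3 : y ≠ 3)
    (hor : (-1 : ℝ) ^ ρ (2 * d x + d 3) * ((S 0).adjugate * S 1).trace < 0)
    (hxdef : (ρ (3 * d x) + ρ (2 * d 3 + d x)) % 2 = 0)
    (hyind : ρ (2 * d y + d 3) % 2 ≠ ρ (2 * d x + d 3) % 2 ∨ (ρ (3 * d y) + ρ (2 * d 3 + d y)) % 2 = 1)
    (hV : (ρ (3 * d x) + ρ (2 * d x + d y)) % 2 + (ρ (2 * d x + d y) + ρ (2 * d y + d x)) % 2 + (ρ (2 * d y + d x) + ρ (3 * d y)) % 2 = 0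
      ∨ (ρ (3 * d x) + ρ (2 * d x + d y)) % 2 + (ρ (2 * d x + d y) + ρ (2 * d y + d x)) % 2 + (ρ (2 * d y + d x) + ρ (3 * d y)) % 2 = 3) :
    ((Matrix.det (∑ l, ((X : ℝ[X]) ^ d l) • (S l).map C)).roots.toFinset.filter (fun t => 0 < t)).card ≤ 16 := by
  have hc : ∀ X : Matrix (Fin 3) (Fin 3) ℝ, ((-S 0).adjugate * (-X)).trace = -(((S 0).adjugate * X).trace) := fun X => by
    rw [show (-S 0).adjugate = (S 0).adjugate from by rw [← neg_one_smul ℝ (S 0), Matrix.adjugate_smul]; simp, Matrix.mul_neg, Matrix.trace_neg]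
  have hdet : ∀ l, ((fun l => -S l) l).det = -(S l).det := fun l => by simp only [Matrix.det_neg, Fintype.card_fin]; norm_num
  have h := card_posRoots_le_16_of_nullNull_topTypeTestDI d hd (fun l => -S l) (fun l => (hS l).neg) (by rw [hdet, h0, neg_zero])
    (by rw [hdet, h3, neg_zero]) hnsd ρ hρ hxy hx0 hx3 hy0 hy3 (by rw [hc, mul_neg]; linarith) hxdef hyind hV
  rwa [posRoots_pencil_neg_three] at h

/-- **TYPE TEST DI from the bottom end `S₀ ⪯ 0`** (transport of `card_posRoots_le_16_of_nullNull_bottomTypeTestDI`). [folklore] -/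
theorem card_posRoots_le_16_of_nullNull_bottomTypeTestDI_neg (d : Fin 4 → ℕ) (hd : StrictMono d) (S : Fin 4 → Matrix (Fin 3) (Fin 3) ℝ)
    (hS : ∀ l, (S l).IsSymm) (h0 : (S 0).det = 0) (h3 : (S 3).det = 0) (hnsd : (-(S 0)).PosSemidef)
    (ρ : ℕ → ℕ) (hρ : ∀ n, ρ n = ((((((Finset.univ : Finset (Sym (Fin 4) 3)).erase (Sym.replicate 3 3)).erase (Sym.replicate 3 0)).image
          (fun s : Sym (Fin 4) 3 => ((s : Multiset (Fin 4)).map d).sum)).filter (· < n)).card))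
    {x y : Fin 4} (hxy : x ≠ y) (hx0 : x ≠ 0) (hx3 : x ≠ 3) (hy0 : y ≠ 0) (hy3 : y ≠ 3)
    (hor : (-1 : ℝ) ^ ρ (2 * d x + d 0) * ((S 0).adjugate * S 1).trace < 0)
    (hxdef : (ρ (3 * d x) + ρ (2 * d 0 + d x)) % 2 = 0)
    (hyind : ρ (2 * d y + d 0) % 2 ≠ ρ (2 * d x + d 0) % 2 ∨ (ρ (3 * d y) + ρ (2 * d 0 + d y)) % 2 = 1)
    (hV : (ρ (3 * d x) + ρ (2 * d x + d y)) % 2 + (ρ (2 * d x + d y) + ρ (2 * d y + d x)) % 2 + (ρ (2 * d y + d x) + ρ (3 * d y)) % 2 = 0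
      ∨ (ρ (3 * d x) + ρ (2 * d x + d y)) % 2 + (ρ (2 * d x + d y) + ρ (2 * d y + d x)) % 2 + (ρ (2 * d y + d x) + ρ (3 * d y)) % 2 = 3) :
    ((Matrix.det (∑ l, ((X : ℝ[X]) ^ d l) • (S l).map C)).roots.toFinset.filter (fun t => 0 < t)).card ≤ 16 := by
  have hc : ∀ X : Matrix (Fin 3) (Fin 3) ℝ, ((-S 0).adjugate * (-X)).trace = -(((S 0).adjugate * X).trace) := fun X => by
    rw [show (-S 0).adjugate = (S 0).adjugate from by rw [← neg_one_smul ℝ (S 0), Matrix.adjugate_smul]; simp, Matrix.mul_neg, Matrix.trace_neg]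
  have hdet : ∀ l, ((fun l => -S l) l).det = -(S l).det := fun l => by simp only [Matrix.det_neg, Fintype.card_fin]; norm_num
  have h := card_posRoots_le_16_of_nullNull_bottomTypeTestDI d hd (fun l => -S l) (fun l => (hS l).neg) (by rw [hdet, h0, neg_zero])
    (by rw [hdet, h3, neg_zero]) hnsd ρ hρ hxy hx0 hx3 hy0 hy3 (by rw [hc, mul_neg]; linarith) hxdef hyind hV
  rwa [posRoots_pencil_neg_three] at h

/-! ## 3. The nappe test read from the bottom end -/

/-- **BOTTOM NAPPE TEST** (mirror of `card_posRoots_le_16_of_nullNull_topNappeTest`): `S₀ ⪰ 0`, a middle letter `x ∈ {1,2}` hidden-definite from the bottom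
end (`c_{0xx} > 0` read off the orientation, `ρ(3d_x) ≡ ρ(2d_0+d_x)`), two further letters `y ≠ z` (both `≠ x`) with `c_{00x}c_{yyx} > 0`, `c_{00x}c_{zzx} > 0`
but `c_{00x}c_{xxy}c_{xxz}c_{xyz} < 0` ⇒ `Z₊ ≤ 16` (`definite_letter_nappe_law`). [folklore] -/
theorem card_posRoots_le_16_of_nullNull_bottomNappeTest (d : Fin 4 → ℕ) (hd : StrictMono d) (S : Fin 4 → Matrix (Fin 3) (Fin 3) ℝ)
    (hS : ∀ l, (S l).IsSymm) (h0 : (S 0).det = 0) (h3 : (S 3).det = 0) (hpsd0 : (S 0).PosSemidef)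
    (ρ : ℕ → ℕ) (hρ : ∀ n, ρ n = ((((((Finset.univ : Finset (Sym (Fin 4) 3)).erase (Sym.replicate 3 3)).erase (Sym.replicate 3 0)).image
          (fun s : Sym (Fin 4) 3 => ((s : Multiset (Fin 4)).map d).sum)).filter (· < n)).card))
    {x y z : Fin 4} (hx0 : x ≠ 0) (hx3 : x ≠ 3) (hyx : y ≠ x) (hzx : z ≠ x) (hyz : y ≠ z)
    (hor : 0 < (-1 : ℝ) ^ ρ (2 * d x + d 0) * ((S 0).adjugate * S 1).trace)
    (hxdef : (ρ (3 * d x) + ρ (2 * d 0 + d x)) % 2 = 0)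
    (hqy : (ρ (2 * d 0 + d x) + ρ (2 * d y + d x)) % 2 = 0) (hqz : (ρ (2 * d 0 + d x) + ρ (2 * d z + d x)) % 2 = 0)
    (hm : (ρ (2 * d 0 + d x) + ρ (2 * d x + d y) + (ρ (2 * d x + d z) + ρ (d y + d z + d x))) % 2 = 1) :
    ((Matrix.det (∑ l, ((X : ℝ[X]) ^ d l) • (S l).map C)).roots.toFinset.filter (fun t => 0 < t)).card ≤ 16 := by
  by_contra hlt
  have h17 : 17 ≤ ((Matrix.det (∑ l, ((X : ℝ[X]) ^ d l) • (S l).map C)).roots.toFinset.filter (fun t => 0 < t)).card := by omega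
  have hρ' : ∀ n, ρ n = ((Matrix.det (∑ l, ((X : ℝ[X]) ^ d l) • (S l).map C)).support.filter (· < n)).card := fun n => by
    rw [hρ, sheetRank_eq_of_nullNull_seventeen d S h0 h3 h17]
  have hqx := bottom_square_pos_of_orientation_nullNull d hd S h0 h3 h17 hx0 ρ hρ' hor
  obtain ⟨hxd, hxiff⟩ := hiddenDefinite_bottom_of_parity_nullNull d hd S hS h0 h3 hpsd0 h17 hx0 hx3 ρ hρ' hqx hxdef
  obtain ⟨cTx, mTx⟩ := coeff_square_of_nullNull_seventeen d hd S h0 h3 h17 0 x hx0.symm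
  obtain ⟨cqy, mqy⟩ := coeff_square_of_nullNull_seventeen d hd S h0 h3 h17 y x hyx
  obtain ⟨cqz, mqz⟩ := coeff_square_of_nullNull_seventeen d hd S h0 h3 h17 z x hzx
  obtain ⟨cTy, mTy⟩ := coeff_square_of_nullNull_seventeen d hd S h0 h3 h17 x y hyx.symm
  obtain ⟨cTz, mTz⟩ := coeff_square_of_nullNull_seventeen d hd S h0 h3 h17 x z hzx.symm
  obtain ⟨cm, mm⟩ := coeff_mixed_of_nullNull_seventeen d hd S h0 h3 h17 y z x hyz hyx hzx
  have ry := (coeff_mul_coeff_sign_of_nullNull_seventeen d S h0 h3 h17 mTx mqy).1 (by rw [← hρ', ← hρ']; exact hqy)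
  have rz := (coeff_mul_coeff_sign_of_nullNull_seventeen d S h0 h3 h17 mTx mqz).1 (by rw [← hρ', ← hρ']; exact hqz)
  rw [cTx, cqy] at ry; rw [cTx, cqz] at rz
  have r1 := coeff_mul_coeff_sign_of_nullNull_seventeen d S h0 h3 h17 mTx mTy
  have r2 := coeff_mul_coeff_sign_of_nullNull_seventeen d S h0 h3 h17 mTz mm
  rw [cTx, cTy, ← hρ', ← hρ'] at r1; rw [cTz, cm, ← hρ', ← hρ'] at r2
  have hneg : ((S 0).adjugate * S x).trace
      * (((S x).adjugate * S y).trace * ((S x).adjugate * S z).trace * (((S y + S z).adjugate - (S y).adjugate - (S z).adjugate) * S x).trace) < 0 := by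
    rcases Nat.mod_two_eq_zero_or_one (ρ (2 * d 0 + d x) + ρ (2 * d x + d y)) with p1 | p1 <;>
    rcases Nat.mod_two_eq_zero_or_one (ρ (2 * d x + d z) + ρ (d y + d z + d x)) with p2 | p2
    · exfalso; omega
    · nlinarith [r1.1 p1, r2.2 p2]
    · nlinarith [r1.2 p1, r2.1 p2]
    · exfalso; omega
  have hTx := trace_adjugate_mul_ne_zero_of_nullNull_seventeen d hd S h0 h3 h17 0 x hx0.symm
  rcases lt_or_gt_of_ne hTx with hn | hp
  · have hN : (-S x).PosDef := by
      rcases hxd with h | h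
      · exact absurd (hxiff.mp h) (not_lt.mpr hn.le)
      · exact h
    have law := definite_letter_nappe_law_neg hN (hS y) (hS z) (by nlinarith [ry, hn]) (by nlinarith [rz, hn])
    nlinarith [law, hn, hneg]
  · have hPx : (S x).PosDef := hxiff.mpr hp
    have law := definite_letter_nappe_law hPx (hS y) (hS z) (by nlinarith [ry, hp]) (by nlinarith [rz, hp])
    nlinarith [law, hp, hneg]

/-- **BOTTOM NAPPE TEST with reading end `S₀ ⪯ 0`** (transport of the previous theorem along `S ↦ −S`; the parity hypotheses are products of an even number of
slot signs and do not change). [folklore] -/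
theorem card_posRoots_le_16_of_nullNull_bottomNappeTest_neg (d : Fin 4 → ℕ) (hd : StrictMono d) (S : Fin 4 → Matrix (Fin 3) (Fin 3) ℝ)
    (hS : ∀ l, (S l).IsSymm) (h0 : (S 0).det = 0) (h3 : (S 3).det = 0) (hnsd0 : (-(S 0)).PosSemidef)
    (ρ : ℕ → ℕ) (hρ : ∀ n, ρ n = ((((((Finset.univ : Finset (Sym (Fin 4) 3)).erase (Sym.replicate 3 3)).erase (Sym.replicate 3 0)).image
          (fun s : Sym (Fin 4) 3 => ((s : Multiset (Fin 4)).map d).sum)).filter (· < n)).card))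
    {x y z : Fin 4} (hx0 : x ≠ 0) (hx3 : x ≠ 3) (hyx : y ≠ x) (hzx : z ≠ x) (hyz : y ≠ z)
    (hor : (-1 : ℝ) ^ ρ (2 * d x + d 0) * ((S 0).adjugate * S 1).trace < 0)
    (hxdef : (ρ (3 * d x) + ρ (2 * d 0 + d x)) % 2 = 0)
    (hqy : (ρ (2 * d 0 + d x) + ρ (2 * d y + d x)) % 2 = 0) (hqz : (ρ (2 * d 0 + d x) + ρ (2 * d z + d x)) % 2 = 0)
    (hm : (ρ (2 * d 0 + d x) + ρ (2 * d x + d y) + (ρ (2 * d x + d z) + ρ (d y + d z + d x))) % 2 = 1) :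
    ((Matrix.det (∑ l, ((X : ℝ[X]) ^ d l) • (S l).map C)).roots.toFinset.filter (fun t => 0 < t)).card ≤ 16 := by
  have hc : ∀ X : Matrix (Fin 3) (Fin 3) ℝ, ((-S 0).adjugate * (-X)).trace = -(((S 0).adjugate * X).trace) := fun X => by
    rw [show (-S 0).adjugate = (S 0).adjugate from by rw [← neg_one_smul ℝ (S 0), Matrix.adjugate_smul]; simp, Matrix.mul_neg, Matrix.trace_neg]
  have hdet : ∀ l, ((fun l => -S l) l).det = -(S l).det := fun l => by simp only [Matrix.det_neg, Fintype.card_fin]; norm_num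
  have h := card_posRoots_le_16_of_nullNull_bottomNappeTest d hd (fun l => -S l) (fun l => (hS l).neg) (by rw [hdet, h0, neg_zero])
    (by rw [hdet, h3, neg_zero]) hnsd0 ρ hρ hx0 hx3 hyx hzx hyz (by rw [hc, mul_neg]; linarith) hxdef hqy hqz hm
  rwa [posRoots_pencil_neg_three] at h

/-! ## 4. Both orientations (appended, g8) -/

/-- **ORIENTATION SPLIT on the null-null sheet.**  If a null-null pencil (sorted support, `det S₀ = det S₃ = 0`) has `Z₊ ≤ 16` whenever `c_{001} = tr(adj S₀·S₁) > 0`,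
and the sign-flipped pencil `−S` has `Z₊ ≤ 16` whenever ITS `c_{001}` is `> 0`, then `Z₊ ≤ 16` outright: on a seventeen `c_{001} ≠ 0`
(`trace_adjugate_mul_ne_zero_of_nullNull_seventeen`), `c_{001}(−S) = −c_{001}(S)`, and `S ↦ −S` keeps the positive det-roots (`posRoots_pencil_neg_three`).  Used by the
orientation-free end-type rows (…NullNullChamberCells*). [folklore] -/
theorem card_posRoots_le_16_of_nullNull_both_orientations (d : Fin 4 → ℕ) (hd : StrictMono d) (S : Fin 4 → Matrix (Fin 3) (Fin 3) ℝ)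
    (h0 : (S 0).det = 0) (h3 : (S 3).det = 0)
    (hp : 0 < ((S 0).adjugate * S 1).trace → ((Matrix.det (∑ l, ((X : ℝ[X]) ^ d l) • (S l).map C)).roots.toFinset.filter (fun t => 0 < t)).card ≤ 16)
    (hn : 0 < ((-S 0).adjugate * (-S 1)).trace →
      ((Matrix.det (∑ l, ((X : ℝ[X]) ^ d l) • (-S l).map C)).roots.toFinset.filter (fun t => 0 < t)).card ≤ 16) :
    ((Matrix.det (∑ l, ((X : ℝ[X]) ^ d l) • (S l).map C)).roots.toFinset.filter (fun t => 0 < t)).card ≤ 16 := by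
  by_contra hlt
  have h17 : 17 ≤ ((Matrix.det (∑ l, ((X : ℝ[X]) ^ d l) • (S l).map C)).roots.toFinset.filter (fun t => 0 < t)).card := by omega
  have hne := trace_adjugate_mul_ne_zero_of_nullNull_seventeen d hd S h0 h3 h17 0 1 (by decide)
  have hc : ((-S 0).adjugate * (-S 1)).trace = -(((S 0).adjugate * S 1).trace) := by
    rw [show (-S 0).adjugate = (S 0).adjugate from by rw [← neg_one_smul ℝ (S 0), Matrix.adjugate_smul]; simp, Matrix.mul_neg, Matrix.trace_neg]
  rcases lt_or_gt_of_ne hne with hneg | hpos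
  · have h := hn (by rw [hc]; linarith)
    rw [posRoots_pencil_neg_three] at h
    exact hlt h
  · exact hlt (hp hpos)

end Summit.ValiantsHypothesis.ValiantsHypothesis.Theorems.LacunarySymmetroidMatrixDescartes.Census
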